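import Literature.LinearAlgebra.Matrix.IntegerMatrixCongruenceInvolutionNormalForm
import Literature.AlgebraicGeometry.ModuliOfAbelianVarieties.SiegelFamilyRealCohomologyDoubleCosets
import HarnessLib

/-!
# Goresky–Tai 2003 §8.3 and §§10.2–10.3 at matrix level: the elements `j_r` (`j̃_r = j_r⁻¹`,
# `j_r² = diag(I_r, −I_s, I_r, −I_s)`), the normal form modulo `2^k` of a `τ`-fixed block-diagonal
# `u = (A 0; 0 ᵗA⁻¹) ∈ Γ_g(2)` with `u² ∈ Γ_g(2^{k+1})` (Lemma 27's core), the step `j_r u j_r ≡ I (2^k)` of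
# Theorem 28, and Proposition 24's identity `ω = τ(gj)(gj)⁻¹ = γ·(gj)(juj)⁻¹(gj)⁻¹ ∈ Γ_g(N)`

Topic `Literature/AlgebraicGeometry/ModuliOfAbelianVarieties` (the Siegel-family files, namespace
`Literature.AlgebraicGeometry.ModuliOfAbelianVarieties.SiegelModuli`).  Lane `lit-hodgefound` (Track 2 foundations
library), prover seat p15 generation 54, row g54-#3; sequel of g54-#1/#2
`Literature/LinearAlgebra/Matrix/IntegerMatrixCongruenceInvolutionNormalForm` (GT's Lemma 26 with its «moreover»
clause, `exists_specialLinearGroup_conj_map_eq_diagonal_of_forall_mem_finset`) in the vocabulary of the seat's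
Goresky–Tai lineage (g52-#5 `SiegelFamilyRealCohomologyDoubleCosets`: `τ(x) = KxK` on `Sp_{2g}(ℤ)` as
`⟨K·x·K, iStar_mul_mul_iStar_mem_symplecticGroup _⟩`, `K = (−1 0; 0 1)`; `(P 0; 0 Q) ∈ Sp ⟺ ᵗPQ = 1`;
`Γ_g(N) = siegelPrincipalGamma g N`, membership `x.map (ℤ → ℤ/N) = 1`).  THEOREMS ONLY: no definition, no instance, no
notation, no named fact (net Literature debt `0`), no `sorry`.  What is NOT here: the boundary components `F`,
`F_q`, the parabolic `P_q`, `ker ν` and the Satake topology of §8 — the tree has no Baily–Borel compactification of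
`Γ∖𝔥_g`; this file isolates the matrix identities that §8.4, §10.2 and §10.3 use, so that Propositions 23–24,
Lemma 27 and Theorem 28 reduce to them once boundary components are available.

## Source, VERBATIM

M. Goresky, Y. S. Tai, *The moduli space of real abelian varieties with level structure*, Compositio Math. **139**
(2003) = arXiv:math/0108103, held `paper:arxiv-math_0108103`.  §8.3 (p0015): «Fix `r` with `q ≤ r ≤ n` and set
`s = n − r`.  Define `j_r = (I_r 0 0 0; 0 0 0 I_s; 0 0 I_r 0; 0 −I_s 0 0)` so `j_r² = (I_r 0 0 0; 0 −I_s 0 0; 0 0 I_r 0;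
0 0 0 −I_s)`.  Then `j̃_r = j_r⁻¹`.»  §8.4 (proof of Proposition 24, p0015–p0016): «Calculate
`ω = τ(gj_r)(gj_r)⁻¹ = γ((gj_r)(j_ruj_r)⁻¹(gj_r)⁻¹) ∈ Γ(4m)` (using the fact that `j̃_r = j_r⁻¹`) which proves the
first statement.»  (Prop. 24: «Suppose that `g(F_q) = F` and that `u = g̃⁻¹γg ∈ ker(ν)`.  Suppose also that there
exists `r` with `q ≤ r ≤ n` so that `j̃_r⁻¹uj_r = j_ruj_r ∈ Γ(4m)`.  Define `ω = τ(gj_r)(gj_r)⁻¹`.  Then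
`ω ∈ Γ(4m)` …».)  §10.2 (proof of Lemma 27, p0018): «By Proposition 23 there exists `γ′ ∈ Γ(2^k)` and there exists
`a ∈ Sp(2n, ℤ)` so that `F^γ = F^{γ′}`, `aF_q = F`, and `u = ã⁻¹γ′a = (A 0; 0 ᵗA⁻¹) ∈ ker(ν)`.  Then
`γ̃′γ′ = au²a⁻¹ ∈ Γ(2^{k+1})` by Lemma 9, hence `A² ≡ I mod 2^{k+1}`.  Moreover, `A ∈ Γ(2)` and `A = (I_q 0; * *)`.
Let `p ∈ GL(n, ℤ)` be the change of basis provided by Lemma 26.  Then `p⁻¹Ap = (I_q 0; * *)` and (after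
re-ordering the coordinates if necessary), `p⁻¹Ap ≡ (I_r 0; 0 −I_s) mod 2^k` for some `r ≥ q`.  Set
`h = (p 0; 0 ᵗp⁻¹) ∈ ker(ν)`.  Set `g = ah`. […] Then `h̃⁻¹uh = g̃⁻¹γ′g ∈ ker(ν)` and `g̃⁻¹γ′g` has the desired form
(10.2).»  §10.3 (proof of Theorem 28, p0018): «so that `u = g̃⁻¹γ₁g` lies in `ker(ν)` and has the form (10.2), for
some `r ≥ q`.  Therefore `j_ruj_r ≡ I mod 2^k` so Proposition 24 may be applied.»

## Rendering

The sign pattern of `(10.2)` is an arbitrary `ε : Fin g → {±1}` (GT order the coordinates so that `ε = (1^r, (−1)^s)`;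
the permutation is not asserted): `j = j(ε) = (d₊ d₋; −d₋ d₊)` with the diagonal idempotents `d₊ = diag(ε = 1)`,
`d₋ = diag(ε = −1)` (`= j_r` for the ordered pattern), `j² = (diag ε 0; 0 diag ε) = diag(I_r, −I_s, I_r, −I_s)`.
The block-diagonal («`∈ GL(n)`», `τ`-fixed by g52-#5 `conjK_mul_mul_conjK_eq_self_iff`) `u = (A 0; 0 D) ∈ Sp_{2g}(ℤ)`
has `ᵗAD = 1`; «`A = (I_q 0; * *)`» is «the rows of `A` indexed by `S ⊆ Fin g` are identity rows».

## What is proved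

* §1 **`jSign_mem_symplecticGroup`** (`j ∈ Sp_{2g}(R)`), **`iStar_mul_jSign_mul_iStar_mul_jSign`** (`τ(j)·j = 1`:
  «`j̃_r = j_r⁻¹`»), **`jSign_mul_jSign`** (`j² = (diag ε 0; 0 diag ε)`), **`jSign_mul_mul_jSign_map_eq_one`**
  (`u ≡ j² (mod N) ⟹ juj ≡ j⁴ = 1 (mod N)`).
* §2 ★ **`exists_blockDiagonal_inv_mul_mul_map_eq_of_mem_siegelPrincipalGamma`** (Lemma 27's core with the
  «moreover» clause: `u = (A 0; 0 D) ∈ Γ_g(2)`, `u² ∈ Γ_g(2^{k+1})`, identity rows of `A` on `S` ⟹ a block-diagonal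
  `h = (p 0; 0 ᵗp⁻¹) ∈ Sp_{2g}(ℤ)` with identity rows on `S` and `ε ∈ {±1}^g`, `ε|_S = 1`, with
  `h⁻¹uh ≡ (diag ε 0; 0 diag ε) (mod 2^k)`), **`jSign_mul_mul_jSign_mem_siegelPrincipalGamma`** (then
  `j(ε)·(h⁻¹uh)·j(ε) ∈ Γ_g(2^k)` — Theorem 28's step).
* §3 **`iStarConj_mul_inv_eq_and_mem_siegelPrincipalGamma`** (Prop. 24's identity and `ω ∈ Γ_g(N)`).

## References

* [GoreskyTai2003RealModuli] M. Goresky, Y. S. Tai, Compositio Math. 139 (2003) 1–27 (arXiv:math/0108103), §8.3,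
  §8.4 (proof of Prop. 24), §10.2 (proof of Lemma 27), §10.3 (proof of Thm. 28).
-/

noncomputable section

open scoped Matrix
open Matrix Function

namespace Literature.AlgebraicGeometry.ModuliOfAbelianVarieties

namespace SiegelModuli

open Literature.NumberTheory.ModularForms.SiegelModularForm (siegelPrincipalGamma mem_siegelPrincipalGamma_iff
  normal_siegelPrincipalGamma)

variable {g : ℕ}

/-! ## §1 The elements `j` (GT's `j_r`, the sign pattern `ε` marking the `r` indices `+1` and the `s` indices `−1`) -/

section J

variable {R : Type*} [CommRing R]

/-- The diagonal idempotents `d₊ = diag(ε = 1)` and `d₋ = diag(ε = −1)` of a sign pattern: `d₊ + d₋ = 1`.  [folklore] -/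
private theorem diag_pos_add_diag_neg (ε : Fin g → ℤ) :
    (diagonal fun i => if ε i = 1 then (1 : R) else 0) + (diagonal fun i => if ε i = 1 then (0 : R) else 1) = 1 := by
  rw [diagonal_add, ← diagonal_one]
  congr 1
  funext i
  split_ifs <;> simp

/-- `d₋ + d₊ = 1`.  [folklore] -/
private theorem diag_neg_add_diag_pos (ε : Fin g → ℤ) :
    (diagonal fun i => if ε i = 1 then (0 : R) else 1) + (diagonal fun i => if ε i = 1 then (1 : R) else 0) = 1 := by
  rw [add_comm, diag_pos_add_diag_neg]

/-- `d₊ − d₋ = diag(ε)` for `ε ∈ {±1}`.  [folklore] -/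
private theorem diag_pos_sub_diag_neg {ε : Fin g → ℤ} (hε : ∀ i, ε i = 1 ∨ ε i = -1) :
    (diagonal fun i => if ε i = 1 then (1 : R) else 0) - (diagonal fun i => if ε i = 1 then (0 : R) else 1) =
      diagonal fun i => (ε i : R) := by
  rw [diagonal_sub]
  congr 1
  funext i
  rcases hε i with h | h
  · simp [h]
  · rw [h, if_neg (by norm_num), if_neg (by norm_num), Int.cast_neg, Int.cast_one, zero_sub]

/-- `d₊² = d₊`.  [folklore] -/
private theorem diag_pos_mul_self (ε : Fin g → ℤ) :
    (diagonal fun i => if ε i = 1 then (1 : R) else 0) * (diagonal fun i => if ε i = 1 then (1 : R) else 0) =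
      diagonal fun i => if ε i = 1 then (1 : R) else 0 := by
  rw [diagonal_mul_diagonal]
  congr 1
  funext i
  split_ifs <;> simp

/-- `d₋² = d₋`.  [folklore] -/
private theorem diag_neg_mul_self (ε : Fin g → ℤ) :
    (diagonal fun i => if ε i = 1 then (0 : R) else 1) * (diagonal fun i => if ε i = 1 then (0 : R) else 1) =
      diagonal fun i => if ε i = 1 then (0 : R) else 1 := by
  rw [diagonal_mul_diagonal]
  congr 1
  funext i
  split_ifs <;> simp

/-- `d₊d₋ = 0`.  [folklore] -/
private theorem diag_pos_mul_diag_neg (ε : Fin g → ℤ) :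
    (diagonal fun i => if ε i = 1 then (1 : R) else 0) * (diagonal fun i => if ε i = 1 then (0 : R) else 1) = 0 := by
  rw [diagonal_mul_diagonal, ← diagonal_zero]
  congr 1
  funext i
  split_ifs <;> simp

/-- `d₋d₊ = 0`.  [folklore] -/
private theorem diag_neg_mul_diag_pos (ε : Fin g → ℤ) :
    (diagonal fun i => if ε i = 1 then (0 : R) else 1) * (diagonal fun i => if ε i = 1 then (1 : R) else 0) = 0 := by
  rw [diagonal_mul_diagonal, ← diagonal_zero]
  congr 1
  funext i
  split_ifs <;> simp

/-- **`j` is symplectic**: GT's `j_r = (I_r 0 0 0; 0 0 0 I_s; 0 0 I_r 0; 0 −I_s 0 0) ∈ Sp(2n, ℤ)` — written for a sign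
pattern `ε ∈ {±1}^g` (`+1` on the `r` indices, `−1` on the `s` indices) as the block matrix
`(d₊ d₋; −d₋ d₊)` with `d₊ = diag(ε = 1)`, `d₋ = diag(ε = −1)`.
[cite: GoreskyTai2003RealModuli, §8.3 («Define `j_r = …`»)] -/
theorem jSign_mem_symplecticGroup (ε : Fin g → ℤ) :
    fromBlocks (diagonal fun i => if ε i = 1 then (1 : R) else 0) (diagonal fun i => if ε i = 1 then (0 : R) else 1)
        (-diagonal fun i => if ε i = 1 then (0 : R) else 1) (diagonal fun i => if ε i = 1 then (1 : R) else 0) ∈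
      Matrix.symplecticGroup (Fin g) R := by
  rw [SymplecticGroup.mem_iff, Matrix.J, fromBlocks_transpose, fromBlocks_multiply, fromBlocks_multiply]
  simp only [diagonal_transpose, transpose_neg, Matrix.mul_zero, Matrix.mul_one, zero_add, add_zero, Matrix.mul_neg,
    Matrix.neg_mul, neg_neg, diag_pos_mul_self, diag_neg_mul_self, diag_pos_mul_diag_neg, diag_neg_mul_diag_pos,
    neg_zero, ← neg_add, diag_pos_add_diag_neg, diag_neg_add_diag_pos]

/-- **`τ(j) = j⁻¹`**, as the matrix identity `(KjK)·j = 1` with `K = (−1 0; 0 1)` («`j̃_r = j_r⁻¹`»).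
[cite: GoreskyTai2003RealModuli, §8.3 («Then `j̃_r = j_r⁻¹`»)] -/
theorem iStar_mul_jSign_mul_iStar_mul_jSign (ε : Fin g → ℤ) :
    fromBlocks (-1 : Matrix (Fin g) (Fin g) R) 0 0 (1 : Matrix (Fin g) (Fin g) R) *
        fromBlocks (diagonal fun i => if ε i = 1 then (1 : R) else 0) (diagonal fun i => if ε i = 1 then (0 : R) else 1)
          (-diagonal fun i => if ε i = 1 then (0 : R) else 1) (diagonal fun i => if ε i = 1 then (1 : R) else 0) *
        fromBlocks (-1 : Matrix (Fin g) (Fin g) R) 0 0 (1 : Matrix (Fin g) (Fin g) R) *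
      fromBlocks (diagonal fun i => if ε i = 1 then (1 : R) else 0) (diagonal fun i => if ε i = 1 then (0 : R) else 1)
        (-diagonal fun i => if ε i = 1 then (0 : R) else 1) (diagonal fun i => if ε i = 1 then (1 : R) else 0) = 1 := by
  rw [iStar_mul_fromBlocks_mul_iStar, fromBlocks_multiply, ← fromBlocks_one]
  simp only [neg_neg, Matrix.mul_neg, Matrix.neg_mul, diag_pos_mul_self, diag_neg_mul_self, diag_pos_mul_diag_neg,
    diag_neg_mul_diag_pos, neg_zero, add_zero, diag_pos_add_diag_neg, diag_neg_add_diag_pos]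

/-- **`j² = diag(ε) ⊕ diag(ε) = diag(I_r, −I_s, I_r, −I_s)`** («so `j_r² = …`»).
[cite: GoreskyTai2003RealModuli, §8.3 («so `j_r² = (I_r 0 0 0; 0 −I_s 0 0; 0 0 I_r 0; 0 0 0 −I_s)`»)] -/
theorem jSign_mul_jSign {ε : Fin g → ℤ} (hε : ∀ i, ε i = 1 ∨ ε i = -1) :
    fromBlocks (diagonal fun i => if ε i = 1 then (1 : R) else 0) (diagonal fun i => if ε i = 1 then (0 : R) else 1)
          (-diagonal fun i => if ε i = 1 then (0 : R) else 1) (diagonal fun i => if ε i = 1 then (1 : R) else 0) *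
        fromBlocks (diagonal fun i => if ε i = 1 then (1 : R) else 0) (diagonal fun i => if ε i = 1 then (0 : R) else 1)
          (-diagonal fun i => if ε i = 1 then (0 : R) else 1) (diagonal fun i => if ε i = 1 then (1 : R) else 0) =
      fromBlocks (diagonal fun i => (ε i : R)) 0 0 (diagonal fun i => (ε i : R)) := by
  rw [fromBlocks_multiply, ← diag_pos_sub_diag_neg hε]
  simp only [Matrix.mul_neg, Matrix.neg_mul, diag_pos_mul_self, diag_neg_mul_self, diag_pos_mul_diag_neg,
    diag_neg_mul_diag_pos, neg_zero, add_zero, sub_eq_add_neg]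
  congr 1
  exact add_comm _ _

/-- `diag(ε)² = 1` for `ε ∈ {±1}`; hence `j⁴ = 1`.  [folklore] -/
private theorem diagonal_sign_mul_self {ε : Fin g → ℤ} (hε : ∀ i, ε i = 1 ∨ ε i = -1) :
    (diagonal fun i => (ε i : R)) * (diagonal fun i => (ε i : R)) = 1 := by
  rw [diagonal_mul_diagonal, ← diagonal_one]
  congr 1
  funext i
  rcases hε i with h | h <;> simp [h]

/-- **The step of Theorem 28**: if `u ≡ j² = diag(I_r, −I_s, I_r, −I_s) (mod N)` then `j u j ≡ j⁴ = 1 (mod N)`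
(«Therefore `j_r u j_r ≡ I mod 2^k` so Proposition 24 may be applied»).
[cite: GoreskyTai2003RealModuli, §10.3 (proof of Theorem 28)] -/
theorem jSign_mul_mul_jSign_map_eq_one {ε : Fin g → ℤ} (hε : ∀ i, ε i = 1 ∨ ε i = -1) {N : ℕ}
    {u : Matrix (Fin g ⊕ Fin g) (Fin g ⊕ Fin g) ℤ}
    (hu : u.map (Int.castRingHom (ZMod N)) =
      fromBlocks (diagonal fun i => (ε i : ZMod N)) 0 0 (diagonal fun i => (ε i : ZMod N))) :
    (fromBlocks (diagonal fun i => if ε i = 1 then (1 : ℤ) else 0) (diagonal fun i => if ε i = 1 then (0 : ℤ) else 1)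
          (-diagonal fun i => if ε i = 1 then (0 : ℤ) else 1) (diagonal fun i => if ε i = 1 then (1 : ℤ) else 0) * u *
        fromBlocks (diagonal fun i => if ε i = 1 then (1 : ℤ) else 0) (diagonal fun i => if ε i = 1 then (0 : ℤ) else 1)
          (-diagonal fun i => if ε i = 1 then (0 : ℤ) else 1) (diagonal fun i => if ε i = 1 then (1 : ℤ) else 0)).map
      (Int.castRingHom (ZMod N)) = 1 := by
  -- the reduction of `j` is the `j` of the same sign pattern over `ℤ/N`
  have hj : (fromBlocks (diagonal fun i => if ε i = 1 then (1 : ℤ) else 0) (diagonal fun i => if ε i = 1 then (0 : ℤ) else 1)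
      (-diagonal fun i => if ε i = 1 then (0 : ℤ) else 1) (diagonal fun i => if ε i = 1 then (1 : ℤ) else 0)).map
        (Int.castRingHom (ZMod N)) =
      fromBlocks (diagonal fun i => if ε i = 1 then (1 : ZMod N) else 0) (diagonal fun i => if ε i = 1 then (0 : ZMod N) else 1)
        (-diagonal fun i => if ε i = 1 then (0 : ZMod N) else 1) (diagonal fun i => if ε i = 1 then (1 : ZMod N) else 0) := by
    rw [fromBlocks_map, Matrix.map_neg _ (map_neg (Int.castRingHom (ZMod N))), diagonal_map (map_zero _),
      diagonal_map (map_zero _)]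
    congr <;> funext i <;> split_ifs <;> simp
  rw [Matrix.map_mul, Matrix.map_mul, hj, hu, ← jSign_mul_jSign hε, Matrix.mul_assoc, Matrix.mul_assoc, jSign_mul_jSign hε,
    ← Matrix.mul_assoc, jSign_mul_jSign hε, fromBlocks_multiply, ← fromBlocks_one]
  simp only [Matrix.mul_zero, Matrix.zero_mul, add_zero, zero_add, diagonal_sign_mul_self hε]

end J

/-! ## §2 The normal form of a `τ`-fixed block-diagonal `u ∈ Γ_g(2)` with `u² ∈ Γ_g(2^{k+1})` (the core of Lemma 27) -/

section NormalForm

/-- In `M_g(ℤ/N)`: if `ĒX = 1` and `Ē² = 1` then `X = Ē`.  [folklore] -/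
private theorem eq_of_mul_eq_one_of_mul_self_eq_one {R : Type*} [CommRing R] {E X : Matrix (Fin g) (Fin g) R}
    (hEX : E * X = 1) (hEE : E * E = 1) : X = E := by
  calc X = E * E * X := by rw [hEE, Matrix.one_mul]
    _ = E := by rw [Matrix.mul_assoc, hEX, Matrix.mul_one]

/-- **Goresky–Tai 2003, §10.2 (the matrix core of Lemma 27), with Lemma 26's «moreover» clause.**  Let
`u = (A 0; 0 D) ∈ Sp_{2g}(ℤ)` be block-diagonal — i.e. `τ(u) = u`, `u` in the image `(A 0; 0 ᵗA⁻¹)` of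
`GL_g(ℤ)` — with `u ∈ Γ_g(2)` («`A ∈ Γ(2)`») and `u² = τ(u)u ∈ Γ_g(2^{k+1})` («`γ̃′γ′ = au²a⁻¹ ∈ Γ(2^{k+1})` … hence
`A² ≡ I mod 2^{k+1}`»), and suppose the rows of `A` indexed by `S` are identity rows («`A = (I_q 0; * *)`»).  Then
there is a block-diagonal `h = (p 0; 0 ᵗp⁻¹) ∈ Sp_{2g}(ℤ)` («Set `h = (p 0; 0 ᵗp⁻¹) ∈ ker(ν)`», `p ∈ SL_g(ℤ)` from
Lemma 26, again with identity rows on `S`) and signs `ε ∈ {±1}^g`, `ε = 1` on `S`, with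
`h⁻¹uh ≡ (diag ε 0; 0 diag ε) (mod 2^k)` («`h̃⁻¹uh = g̃⁻¹γ′g ∈ ker(ν)` and has the desired form (10.2)»; GT then
re-order the coordinates to `diag(I_r, −I_s, I_r, −I_s)`, `r ≥ q` — a permutation, not asserted here).  The lower
block: `ᵗp ᵗA⁻¹ ᵗp⁻¹ ≡ diag(ε)⁻¹ = diag(ε)`.  [cite: GoreskyTai2003RealModuli, §10.2 (proof of Lemma 27)] -/
theorem exists_blockDiagonal_inv_mul_mul_map_eq_of_mem_siegelPrincipalGamma (k : ℕ) (S : Finset (Fin g))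
    (u : Matrix.symplecticGroup (Fin g) ℤ)
    (hu₁₂ : (u : Matrix (Fin g ⊕ Fin g) (Fin g ⊕ Fin g) ℤ).toBlocks₁₂ = 0)
    (hu₂₁ : (u : Matrix (Fin g ⊕ Fin g) (Fin g ⊕ Fin g) ℤ).toBlocks₂₁ = 0)
    (hS : ∀ i ∈ S, ∀ j, (u : Matrix (Fin g ⊕ Fin g) (Fin g ⊕ Fin g) ℤ).toBlocks₁₁ i j = (1 : Matrix (Fin g) (Fin g) ℤ) i j)
    (h2 : u ∈ siegelPrincipalGamma g 2) (hk : u * u ∈ siegelPrincipalGamma g (2 ^ (k + 1))) :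
    ∃ h : Matrix.symplecticGroup (Fin g) ℤ,
      (h : Matrix (Fin g ⊕ Fin g) (Fin g ⊕ Fin g) ℤ).toBlocks₁₂ = 0 ∧
      (h : Matrix (Fin g ⊕ Fin g) (Fin g ⊕ Fin g) ℤ).toBlocks₂₁ = 0 ∧
      (∀ i ∈ S, ∀ j, (h : Matrix (Fin g ⊕ Fin g) (Fin g ⊕ Fin g) ℤ).toBlocks₁₁ i j = (1 : Matrix (Fin g) (Fin g) ℤ) i j) ∧
      ∃ ε : Fin g → ℤ, (∀ i, ε i = 1 ∨ ε i = -1) ∧ (∀ i ∈ S, ε i = 1) ∧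
        ((h⁻¹ * u * h : Matrix.symplecticGroup (Fin g) ℤ) : Matrix (Fin g ⊕ Fin g) (Fin g ⊕ Fin g) ℤ).map
            (Int.castRingHom (ZMod (2 ^ k))) =
          fromBlocks (diagonal fun i => (ε i : ZMod (2 ^ k))) 0 0 (diagonal fun i => (ε i : ZMod (2 ^ k))) := by
  set A := (u : Matrix (Fin g ⊕ Fin g) (Fin g ⊕ Fin g) ℤ).toBlocks₁₁ with hA
  set D := (u : Matrix (Fin g ⊕ Fin g) (Fin g ⊕ Fin g) ℤ).toBlocks₂₂ with hD
  have hu : (u : Matrix (Fin g ⊕ Fin g) (Fin g ⊕ Fin g) ℤ) = fromBlocks A 0 0 D := by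
    rw [← fromBlocks_toBlocks (u : Matrix (Fin g ⊕ Fin g) (Fin g ⊕ Fin g) ℤ), hu₁₂, hu₂₁]
  have hAD : Aᵀ * D = 1 := (fromBlocks_zero_zero_mem_symplecticGroup_iff A D).1 (hu ▸ u.2)
  -- `A ≡ 1 (2)`, `A² ≡ 1 (2^{k+1})`
  have h1A : A.map (Int.castRingHom (ZMod 2)) = 1 := by
    have h := mem_siegelPrincipalGamma_iff.1 h2
    rw [hu, fromBlocks_map, Matrix.map_zero _ (map_zero _), ← fromBlocks_one] at h
    exact (Matrix.fromBlocks_inj.1 h).1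
  have h2A : (A * A).map (Int.castRingHom (ZMod (2 ^ (k + 1)))) = 1 := by
    have h := mem_siegelPrincipalGamma_iff.1 hk
    rw [Submonoid.coe_mul, hu, fromBlocks_multiply, fromBlocks_map] at h
    simp only [Matrix.mul_zero, Matrix.zero_mul, add_zero, zero_add, Matrix.map_zero _ (map_zero _)] at h
    rw [← fromBlocks_one] at h
    exact (Matrix.fromBlocks_inj.1 h).1
  obtain ⟨p, hpS, ε, hε, hεS, hconj⟩ :=
    Literature.LinearAlgebra.Matrix.exists_specialLinearGroup_conj_map_eq_diagonal_of_forall_mem_finset k S A hS h1A h2A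
  -- `h = (p 0; 0 ᵗp⁻¹)` and its inverse `(p⁻¹ 0; 0 ᵗp)`
  set q : Matrix (Fin g) (Fin g) ℤ := ((p.transpose⁻¹ : Matrix.SpecialLinearGroup (Fin g) ℤ) : Matrix (Fin g) (Fin g) ℤ)
    with hq
  have hpq : (p : Matrix (Fin g) (Fin g) ℤ)ᵀ * q = 1 := by
    have h := congrArg (fun x : Matrix.SpecialLinearGroup (Fin g) ℤ => (x : Matrix (Fin g) (Fin g) ℤ))
      (mul_inv_cancel p.transpose)
    simpa only [Matrix.SpecialLinearGroup.coe_mul, Matrix.SpecialLinearGroup.coe_one,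
      Matrix.SpecialLinearGroup.coe_transpose] using h
  have hpp : (p : Matrix (Fin g) (Fin g) ℤ) * ((p⁻¹ : Matrix.SpecialLinearGroup (Fin g) ℤ) : Matrix (Fin g) (Fin g) ℤ) = 1 := by
    rw [← Matrix.SpecialLinearGroup.coe_mul, mul_inv_cancel, Matrix.SpecialLinearGroup.coe_one]
  have hpp' : ((p⁻¹ : Matrix.SpecialLinearGroup (Fin g) ℤ) : Matrix (Fin g) (Fin g) ℤ) * (p : Matrix (Fin g) (Fin g) ℤ) = 1 := by
    rw [← Matrix.SpecialLinearGroup.coe_mul, inv_mul_cancel, Matrix.SpecialLinearGroup.coe_one]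
  have hmem : fromBlocks (p : Matrix (Fin g) (Fin g) ℤ) 0 0 q ∈ Matrix.symplecticGroup (Fin g) ℤ :=
    (fromBlocks_zero_zero_mem_symplecticGroup_iff _ _).2 hpq
  have hmem' : fromBlocks ((p⁻¹ : Matrix.SpecialLinearGroup (Fin g) ℤ) : Matrix (Fin g) (Fin g) ℤ) 0 0
      (p : Matrix (Fin g) (Fin g) ℤ)ᵀ ∈ Matrix.symplecticGroup (Fin g) ℤ := by
    refine (fromBlocks_zero_zero_mem_symplecticGroup_iff _ _).2 ?_
    rw [← transpose_mul, hpp, transpose_one]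
  let h : Matrix.symplecticGroup (Fin g) ℤ := ⟨_, hmem⟩
  let h' : Matrix.symplecticGroup (Fin g) ℤ := ⟨_, hmem'⟩
  have hh : h' * h = 1 := by
    apply Subtype.ext
    change fromBlocks ((p⁻¹ : Matrix.SpecialLinearGroup (Fin g) ℤ) : Matrix (Fin g) (Fin g) ℤ) 0 0
        (p : Matrix (Fin g) (Fin g) ℤ)ᵀ * fromBlocks (p : Matrix (Fin g) (Fin g) ℤ) 0 0 q = 1
    rw [fromBlocks_multiply, ← fromBlocks_one]
    simp only [Matrix.mul_zero, Matrix.zero_mul, add_zero, zero_add, hpp', hpq]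
  have hinv : h⁻¹ = h' := inv_eq_of_mul_eq_one_left hh
  refine ⟨h, by simp [h], by simp [h], fun i hi j => by simpa [h] using hpS i hi j, ε, hε, hεS, ?_⟩
  rw [hinv]
  change (fromBlocks ((p⁻¹ : Matrix.SpecialLinearGroup (Fin g) ℤ) : Matrix (Fin g) (Fin g) ℤ) 0 0
      (p : Matrix (Fin g) (Fin g) ℤ)ᵀ * (u : Matrix (Fin g ⊕ Fin g) (Fin g ⊕ Fin g) ℤ) *
      fromBlocks (p : Matrix (Fin g) (Fin g) ℤ) 0 0 q).map _ = _
  rw [hu, fromBlocks_multiply, fromBlocks_multiply, fromBlocks_map]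
  simp only [Matrix.mul_zero, Matrix.zero_mul, add_zero, zero_add, Matrix.map_zero _ (map_zero _)]
  rw [hconj]
  congr 1
  -- the lower block `ᵗp D q ≡ diag(ε)` in `M_g(ℤ/2^k)`
  have hE2 : (diagonal fun i => (ε i : ZMod (2 ^ k))) * (diagonal fun i => (ε i : ZMod (2 ^ k))) = 1 :=
    diagonal_sign_mul_self hε
  have hAP : A.map (Int.castRingHom (ZMod (2 ^ k))) * (p : Matrix (Fin g) (Fin g) ℤ).map (Int.castRingHom (ZMod (2 ^ k))) =
      (p : Matrix (Fin g) (Fin g) ℤ).map (Int.castRingHom (ZMod (2 ^ k))) * diagonal fun i => (ε i : ZMod (2 ^ k)) := by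
    rw [← hconj, ← Matrix.map_mul, ← Matrix.map_mul, ← Matrix.mul_assoc, ← Matrix.mul_assoc, hpp, Matrix.one_mul]
  apply eq_of_mul_eq_one_of_mul_self_eq_one _ hE2
  rw [Matrix.map_mul, Matrix.map_mul, ← Matrix.mul_assoc, ← Matrix.mul_assoc, transpose_map, ← diagonal_transpose,
    ← transpose_mul, ← hAP, transpose_mul, ← transpose_map, ← transpose_map, Matrix.mul_assoc _ (Aᵀ.map _),
    ← Matrix.map_mul, hAD, Matrix.map_one _ (map_zero _) (map_one _), Matrix.mul_one, ← Matrix.map_mul, hpq,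
    Matrix.map_one _ (map_zero _) (map_one _)]

/-- **Theorem 28's step, assembled**: with `h`, `ε` as above and `j = j(ε)`, `j·(h⁻¹uh)·j ∈ Γ_g(2^k)`
(«`u = g̃⁻¹γ₁g` … has the form (10.2), for some `r ≥ q`.  Therefore `j_r u j_r ≡ I mod 2^k` so Proposition 24 may be
applied»).  [cite: GoreskyTai2003RealModuli, §10.3 (proof of Theorem 28)] -/
theorem jSign_mul_mul_jSign_mem_siegelPrincipalGamma {k : ℕ} {ε : Fin g → ℤ} (hε : ∀ i, ε i = 1 ∨ ε i = -1)
    (v : Matrix.symplecticGroup (Fin g) ℤ)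
    (hv : (v : Matrix (Fin g ⊕ Fin g) (Fin g ⊕ Fin g) ℤ).map (Int.castRingHom (ZMod (2 ^ k))) =
      fromBlocks (diagonal fun i => (ε i : ZMod (2 ^ k))) 0 0 (diagonal fun i => (ε i : ZMod (2 ^ k)))) :
    (⟨fromBlocks (diagonal fun i => if ε i = 1 then (1 : ℤ) else 0) (diagonal fun i => if ε i = 1 then (0 : ℤ) else 1)
          (-diagonal fun i => if ε i = 1 then (0 : ℤ) else 1) (diagonal fun i => if ε i = 1 then (1 : ℤ) else 0),
        jSign_mem_symplecticGroup ε⟩ * v *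
      ⟨fromBlocks (diagonal fun i => if ε i = 1 then (1 : ℤ) else 0) (diagonal fun i => if ε i = 1 then (0 : ℤ) else 1)
          (-diagonal fun i => if ε i = 1 then (0 : ℤ) else 1) (diagonal fun i => if ε i = 1 then (1 : ℤ) else 0),
        jSign_mem_symplecticGroup ε⟩ : Matrix.symplecticGroup (Fin g) ℤ) ∈ siegelPrincipalGamma g (2 ^ k) := by
  rw [mem_siegelPrincipalGamma_iff, Submonoid.coe_mul, Submonoid.coe_mul]
  exact jSign_mul_mul_jSign_map_eq_one hε hv

end NormalForm

/-! ## §3 Proposition 24's identity: `ω = τ(gj)(gj)⁻¹ = γ·((gj)(juj)⁻¹(gj)⁻¹) ∈ Γ_g(N)` -/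

section Omega

/-- **Goresky–Tai 2003, §8.4 (proof of Proposition 24), the group-theoretic identity.**  For `γ, g, j ∈ Sp_{2g}(ℤ)`
with `τ(j) = j⁻¹`, put `u = τ(g)⁻¹γg` and `ω = τ(gj)(gj)⁻¹`; then «`ω = τ(gj_r)(gj_r)⁻¹ = γ((gj_r)(j_ruj_r)⁻¹(gj_r)⁻¹)`
… (using the fact that `j̃_r = j_r⁻¹`)», and consequently `ω ∈ Γ_g(N)` as soon as `γ ∈ Γ_g(N)` and `j u j ∈ Γ_g(N)`
(`Γ_g(N)` is normal).  Here `τ(x) = KxK`, `K = (−1 0; 0 1)`.  [cite: GoreskyTai2003RealModuli, §8.4 (proof of Proposition 24)] -/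
theorem iStarConj_mul_inv_eq_and_mem_siegelPrincipalGamma (N : ℕ) (γ x j : Matrix.symplecticGroup (Fin g) ℤ)
    (hj : (⟨fromBlocks (-1 : Matrix (Fin g) (Fin g) ℤ) 0 0 (1 : Matrix (Fin g) (Fin g) ℤ) *
          (j : Matrix (Fin g ⊕ Fin g) (Fin g ⊕ Fin g) ℤ) * fromBlocks (-1 : Matrix (Fin g) (Fin g) ℤ) 0 0 (1 : Matrix (Fin g) (Fin g) ℤ),
        iStar_mul_mul_iStar_mem_symplecticGroup j.2⟩ : Matrix.symplecticGroup (Fin g) ℤ) = j⁻¹)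
    (hγ : γ ∈ siegelPrincipalGamma g N)
    (hu : j * ((⟨fromBlocks (-1 : Matrix (Fin g) (Fin g) ℤ) 0 0 (1 : Matrix (Fin g) (Fin g) ℤ) *
          (x : Matrix (Fin g ⊕ Fin g) (Fin g ⊕ Fin g) ℤ) * fromBlocks (-1 : Matrix (Fin g) (Fin g) ℤ) 0 0 (1 : Matrix (Fin g) (Fin g) ℤ),
        iStar_mul_mul_iStar_mem_symplecticGroup x.2⟩ : Matrix.symplecticGroup (Fin g) ℤ)⁻¹ * γ * x) * j ∈
      siegelPrincipalGamma g N) :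
    (⟨fromBlocks (-1 : Matrix (Fin g) (Fin g) ℤ) 0 0 (1 : Matrix (Fin g) (Fin g) ℤ) *
          ((x * j : Matrix.symplecticGroup (Fin g) ℤ) : Matrix (Fin g ⊕ Fin g) (Fin g ⊕ Fin g) ℤ) *
          fromBlocks (-1 : Matrix (Fin g) (Fin g) ℤ) 0 0 (1 : Matrix (Fin g) (Fin g) ℤ),
        iStar_mul_mul_iStar_mem_symplecticGroup (x * j).2⟩ : Matrix.symplecticGroup (Fin g) ℤ) * (x * j)⁻¹ =
      γ * ((x * j) * (j * ((⟨fromBlocks (-1 : Matrix (Fin g) (Fin g) ℤ) 0 0 (1 : Matrix (Fin g) (Fin g) ℤ) *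
          (x : Matrix (Fin g ⊕ Fin g) (Fin g ⊕ Fin g) ℤ) * fromBlocks (-1 : Matrix (Fin g) (Fin g) ℤ) 0 0 (1 : Matrix (Fin g) (Fin g) ℤ),
        iStar_mul_mul_iStar_mem_symplecticGroup x.2⟩ : Matrix.symplecticGroup (Fin g) ℤ)⁻¹ * γ * x) * j)⁻¹ * (x * j)⁻¹) ∧
    (⟨fromBlocks (-1 : Matrix (Fin g) (Fin g) ℤ) 0 0 (1 : Matrix (Fin g) (Fin g) ℤ) *
          ((x * j : Matrix.symplecticGroup (Fin g) ℤ) : Matrix (Fin g ⊕ Fin g) (Fin g ⊕ Fin g) ℤ) *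
          fromBlocks (-1 : Matrix (Fin g) (Fin g) ℤ) 0 0 (1 : Matrix (Fin g) (Fin g) ℤ),
        iStar_mul_mul_iStar_mem_symplecticGroup (x * j).2⟩ : Matrix.symplecticGroup (Fin g) ℤ) * (x * j)⁻¹ ∈
      siegelPrincipalGamma g N := by
  have hτ : (⟨fromBlocks (-1 : Matrix (Fin g) (Fin g) ℤ) 0 0 (1 : Matrix (Fin g) (Fin g) ℤ) *
          ((x * j : Matrix.symplecticGroup (Fin g) ℤ) : Matrix (Fin g ⊕ Fin g) (Fin g ⊕ Fin g) ℤ) *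
          fromBlocks (-1 : Matrix (Fin g) (Fin g) ℤ) 0 0 (1 : Matrix (Fin g) (Fin g) ℤ),
        iStar_mul_mul_iStar_mem_symplecticGroup (x * j).2⟩ : Matrix.symplecticGroup (Fin g) ℤ) =
      (⟨fromBlocks (-1 : Matrix (Fin g) (Fin g) ℤ) 0 0 (1 : Matrix (Fin g) (Fin g) ℤ) *
          (x : Matrix (Fin g ⊕ Fin g) (Fin g ⊕ Fin g) ℤ) * fromBlocks (-1 : Matrix (Fin g) (Fin g) ℤ) 0 0 (1 : Matrix (Fin g) (Fin g) ℤ),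
        iStar_mul_mul_iStar_mem_symplecticGroup x.2⟩ : Matrix.symplecticGroup (Fin g) ℤ) * j⁻¹ := by
    rw [conjK_mk_mul, hj]
  have hid : (⟨fromBlocks (-1 : Matrix (Fin g) (Fin g) ℤ) 0 0 (1 : Matrix (Fin g) (Fin g) ℤ) *
          ((x * j : Matrix.symplecticGroup (Fin g) ℤ) : Matrix (Fin g ⊕ Fin g) (Fin g ⊕ Fin g) ℤ) *
          fromBlocks (-1 : Matrix (Fin g) (Fin g) ℤ) 0 0 (1 : Matrix (Fin g) (Fin g) ℤ),
        iStar_mul_mul_iStar_mem_symplecticGroup (x * j).2⟩ : Matrix.symplecticGroup (Fin g) ℤ) * (x * j)⁻¹ =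
      γ * ((x * j) * (j * ((⟨fromBlocks (-1 : Matrix (Fin g) (Fin g) ℤ) 0 0 (1 : Matrix (Fin g) (Fin g) ℤ) *
          (x : Matrix (Fin g ⊕ Fin g) (Fin g ⊕ Fin g) ℤ) * fromBlocks (-1 : Matrix (Fin g) (Fin g) ℤ) 0 0 (1 : Matrix (Fin g) (Fin g) ℤ),
        iStar_mul_mul_iStar_mem_symplecticGroup x.2⟩ : Matrix.symplecticGroup (Fin g) ℤ)⁻¹ * γ * x) * j)⁻¹ * (x * j)⁻¹) := by
    rw [hτ]
    group
  refine ⟨hid, ?_⟩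
  rw [hid]
  exact (siegelPrincipalGamma g N).mul_mem hγ
    ((normal_siegelPrincipalGamma (n := g) (q := N)).conj_mem _ ((siegelPrincipalGamma g N).inv_mem hu) _)

end Omega

end SiegelModuli

end Literature.AlgebraicGeometry.ModuliOfAbelianVarieties
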